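import Summits.BirchSwinnertonDyer.Rank1Residual.P2.CongruentNumberSilentEvenFiveRankDescent
import Summits.BirchSwinnertonDyer.Rank1Residual.P2.CongruentNumberSilentEvenFiveEnclosureParam
import HarnessLib

/-!
# Cell «bsd-monsky» (typer): THE RANK AXIS OF C-P2-1 ON `𝒮⁻` FROM THE CUSP / PARAM SYSTEM FACTS ALONE — clause (a)
# `ord_{s=1} L(E_{2pq}, s) = 1`, rank one, «`2pq` congruent» and the `Ш_an`-unit form from `hSys⁵` / `hSys⁶`, with no
# `2`-Selmer input; the `2`-Selmer input (`hAo`) serves clause (b) only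

HONEST FRAMING (cell `bsd-monsky`, run/shared/lean/pub/bsd-monsky/, README §1: ONE theorem on ONE explicit infinite
family of quadratic twists of the congruent number curve at the prime `2`; nothing booked until the cross-family referee
passes the written proof). This file asserts NO arithmetic fact: it is the bookkeeping twin, for the typer's corners of
record `tian2014_system_sMinus_cusp` (`hSys⁵`, p454553 / p454904) and `tian2014_system_sMinus_param` (`hSys⁶`, p457324 /
p457499), of prover-A's `CongruentNumberSilentEvenFiveRankDescent.lean` §4–§5 (`…_of_maximalSystem_rankDescent`,
p458378): the first `2`-descent of Lagrange 1975 / PROOF-A Lemma 7.1 (a) is a kernel theorem (`rk E_{2pq}(ℚ) ≤ 1` on the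
whole family `2p₅q₃`), the system fact hands the point `y ∉ 2E + tor`, so rank one, the odd-index datum, clause (a) and
the `Ш_an`-unit form `CongruentSilentEvenFiveOrdTwo` follow from the system fact ALONE. One-line compositions through
`tian2014_system_sMinus_maximal_of_cusp` / `…_of_param`; nothing booked; no mark moved.

References: [Lagrange1975] §11 table p. 16-12; [Tian2014] Def. 2.7, Thm. 2.8, Prop. 2.1, p0003 L3–L5 (J119);
[TianYuanZhang2017] Thm. 1.1, Thm. 3.3, J733, J741, J747, J751, Lemma 3.16 (J754); [Monsky1990MockHeegner] Thm. 5.5,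
Thm. 5.9 (1), Cor. 5.15 (2′); [Aoki1999] Thm. 2.2; [Miller2011LMS] Def. 1.1.
-/

noncomputable section

open scoped Classical

open WeierstrassCurve Literature.NumberTheory.EllipticCurves
  Literature.NumberTheory.EllipticCurves.Rank1Residual
  Literature.NumberTheory.EllipticCurves.Rank1Residual.Typed

set_option autoImplicit false

namespace Summit.BirchSwinnertonDyer.Rank1Residual.P2

open Conjectures Literature.NumberTheory.EllipticCurves.Tian2014

/-! ## §1 The cusp system fact alone (`hSys⁵`) -/

/-- **C-P2-1, SHARPER (`Ш_an`-unit) FORM, from the cusp system fact ALONE** (`hSys⁵`, `tian2014_system_sMinus_cusp`): clause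
(a) and `#Ш_an(E_{2pq})` a `2`-adic unit on all of `𝒮⁻` with NO `2`-Selmer input. Conditional; nothing asserted.
[cite: Tian2014, Def. 2.7, Prop. 2.1] [cite: TianYuanZhang2017, Thm. 3.3, J741, J747, J751, Lemma 3.16 (J754)]
[cite: Lagrange1975, §11 table p. 16-12] -/
theorem congruentSilentEvenFiveOrdTwo_of_cuspSystem_rankDescent (hSys : tian2014_system_sMinus_cusp) :
    CongruentSilentEvenFiveOrdTwo :=
  congruentSilentEvenFiveOrdTwo_of_maximalSystem_rankDescent (tian2014_system_sMinus_maximal_of_cusp hSys)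

/-- **Clause (a) on all of `𝒮⁻` from the cusp system fact alone**: `ord_{s=1} L(E_{2pq}, s) = 1`.
[cite: TianYuanZhang2017, Thm. 1.1, Thm. 3.3] [cite: Lagrange1975, §11 table p. 16-12] -/
theorem analyticRank_eq_one_of_cuspSystem_rankDescent (hSys : tian2014_system_sMinus_cusp) :
    ∀ p q : ℕ, p.Prime → q.Prime → p % 8 = 5 → q % 4 = 3 → jacobiSym p q = -1 →
      (congruentNumberCurve (2 * (p * q))).analyticRank = 1 :=
  analyticRank_eq_one_of_maximalSystem_rankDescent (tian2014_system_sMinus_maximal_of_cusp hSys)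

/-- **Rank one on all of `𝒮⁻` from the cusp system fact alone.** [cite: Lagrange1975, §11 table p. 16-12]
[cite: Monsky1990MockHeegner, Thm. 5.5 (p. 62), Thm. 5.9 (1) (pp. 63–64)] -/
theorem mordellWeilRank_eq_one_of_cuspSystem_rankDescent (hSys : tian2014_system_sMinus_cusp) :
    ∀ p q : ℕ, p.Prime → q.Prime → p % 8 = 5 → q % 4 = 3 → jacobiSym p q = -1 →
      (congruentNumberCurve (2 * (p * q))).mordellWeilRank = 1 :=
  mordellWeilRank_eq_one_of_maximalSystem_rankDescent (tian2014_system_sMinus_maximal_of_cusp hSys)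

/-! ## §2 The param system fact alone (`hSys⁶`, the corner of record of OFFER-M v1.6) -/

/-- **C-P2-1, SHARPER (`Ш_an`-unit) FORM, from the param system fact ALONE** (`hSys⁶`, `tian2014_system_sMinus_param`,
the corner of record): clause (a) and `#Ш_an(E_{2pq})` a `2`-adic unit on all of `𝒮⁻` with NO `2`-Selmer input.
Conditional; nothing asserted. [cite: Tian2014, Def. 2.7, Prop. 2.1, p0003 L3–L5 (J119)]
[cite: TianYuanZhang2017, Thm. 3.3, J733, J741, J747, J751, Lemma 3.16 (J754)] [cite: Lagrange1975, §11 table p. 16-12] -/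
theorem congruentSilentEvenFiveOrdTwo_of_paramSystem_rankDescent (hSys : tian2014_system_sMinus_param) :
    CongruentSilentEvenFiveOrdTwo :=
  congruentSilentEvenFiveOrdTwo_of_maximalSystem_rankDescent (tian2014_system_sMinus_maximal_of_param hSys)

/-- **Clause (a) on all of `𝒮⁻` from the param system fact alone**: `ord_{s=1} L(E_{2pq}, s) = 1`.
[cite: TianYuanZhang2017, Thm. 1.1, Thm. 3.3] [cite: Lagrange1975, §11 table p. 16-12] -/
theorem analyticRank_eq_one_of_paramSystem_rankDescent (hSys : tian2014_system_sMinus_param) :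
    ∀ p q : ℕ, p.Prime → q.Prime → p % 8 = 5 → q % 4 = 3 → jacobiSym p q = -1 →
      (congruentNumberCurve (2 * (p * q))).analyticRank = 1 :=
  analyticRank_eq_one_of_maximalSystem_rankDescent (tian2014_system_sMinus_maximal_of_param hSys)

/-- **Rank one on all of `𝒮⁻` from the param system fact alone.** [cite: Lagrange1975, §11 table p. 16-12]
[cite: Monsky1990MockHeegner, Thm. 5.5 (p. 62), Thm. 5.9 (1) (pp. 63–64)] -/
theorem mordellWeilRank_eq_one_of_paramSystem_rankDescent (hSys : tian2014_system_sMinus_param) :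
    ∀ p q : ℕ, p.Prime → q.Prime → p % 8 = 5 → q % 4 = 3 → jacobiSym p q = -1 →
      (congruentNumberCurve (2 * (p * q))).mordellWeilRank = 1 :=
  mordellWeilRank_eq_one_of_maximalSystem_rankDescent (tian2014_system_sMinus_maximal_of_param hSys)

/-- **`2pq` is a congruent number for every `(p, q)` of `𝒮⁻`, from the param system fact alone.**
[cite: Monsky1990MockHeegner, Cor. 5.15 (2′) (p. 66)] [cite: Lagrange1975, §11 table p. 16-12] -/
theorem isCongruentNumber_two_mul_five_mul_of_paramSystem_rankDescent (hSys : tian2014_system_sMinus_param) :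
    ∀ p q : ℕ, p.Prime → q.Prime → p % 8 = 5 → q % 4 = 3 → jacobiSym p q = -1 →
      IsCongruentNumber (2 * (p * q)) :=
  isCongruentNumber_two_mul_five_mul_of_system_rankDescent (tian2014_monsky1990_system_sMinus_of_genus
    (tian2014_system_sMinus_genus_of_split (tian2014_system_sMinus_split_of_bridged
      (tian2014_system_sMinus_bridged_of_maximal (tian2014_system_sMinus_maximal_of_param hSys)))))

/-! ## §3 Bookkeeping on the corner of record: the `2`-Selmer input serves clause (b) only -/

/-- **C-P2-1 (observable form) on the corner of record `{hAo, hSys⁶}`, with the division of labour visible**: `hSys⁶`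
alone gives the sharper form (§2); `hAo` converts `Ш_an` into `Ш` (`congruentSilentEvenFiveBSDTwo_of_paramSystem_of_aoki`).
Conditional; nothing asserted. [cite: Aoki1999, Thm. 2.2 p. 81] [cite: Tian2014, Def. 2.7, Prop. 2.1, p0003 L3–L5 (J119)]
[cite: TianYuanZhang2017, Thm. 3.3, J733, J741, J747, J751, Lemma 3.16 (J754)] [cite: Miller2011LMS, Def. 1.1] -/
theorem congruentSilentEvenFiveBSDTwo_of_paramSystem_of_aoki_rankDescent
    (hAo : Literature.NumberTheory.EllipticCurves.Aoki1999.thm22_card_selmerGroup_two)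
    (hSys : tian2014_system_sMinus_param) :
    CongruentSilentEvenFiveOrdTwo ∧ CongruentSilentEvenFiveBSDTwo :=
  ⟨congruentSilentEvenFiveOrdTwo_of_paramSystem_rankDescent hSys,
    congruentSilentEvenFiveBSDTwo_of_paramSystem_of_aoki hAo hSys⟩

end Summit.BirchSwinnertonDyer.Rank1Residual.P2

end
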